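import Mathlib
import HarnessLib

/-!
# [OURS · L0 W4.1] K-GG1 (D1)(D2): the λ-decomposition of a power series over a field of characteristic 2 with a finite 2-basis,
# and square classes modulo a monomial ideal (chain W4.1 `FrobeniusClosingSteer`, crux stmt-ResolutionOfSingularities-16345;
# custody DEAL #31 (1) → res-D-lib-1; res-L0-w41-plan-1 RULING 192b FILE A; `--supports … --as helper`)

HONEST FRAMING. OURS kernel file (HIRONAKA-L librarian res-D-lib-1 gen 7) proving, EXACTLY AS TYPED by res-L0-w41-tri-3
(`L/res-L0-w41-tri-3/kgg/KGG15_signature.lean` 90f9b13c9a2f0289, after res-L0-w41-tri-1's `v621/KGG-signatures.md` 036f669dd3fa960c), the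
two K-GG1 items (D1)/(D2). Setting: `K` a field with `CharP K 2`, `V = MvPowerSeries (Fin c) K`, a FINITE 2-BASIS carried as data
`λ : Fin r → K` with the hypothesis `IsTwoBasis λ` (every `a ∈ K` is uniquely `∑_ε λ^ε b_ε²`, `ε : Fin r → Fin 2`; Matsumura §26 «p-basis», p = 2,
finite case — Mathlib has no `IsPBasis`, so the two vocabulary definitions `lamPow` / `IsTwoBasis` are OURS).

* (D1) `lambdaDecomp_existsUnique` — every `F ∈ V` is uniquely `F = ∑_ε C(λ^ε)·(D₁ ε)² + D₂` with `D₂` supported on exponents having an odd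
  entry. Proof (tri-1): coefficientwise — in characteristic 2 the square of a power series is `∑ b_α² v^{2α}` (`coeff_two_nsmul_sq`,
  `coeff_sq_eq_zero_of_not_even`: the swap involution on the antidiagonal), so `coeff (2•α) F = ∑_ε λ^ε (coeff α (D₁ ε))²` is solved uniquely
  by the 2-basis; `sqPart` / `oddPart` are the `choose` components, with their coefficient API.
* (D2) `exists_sub_sq_mem_iff_of_isMonomial` — for an ideal `J ⊆ V` closed under taking monomial components, `F − g² ∈ J` for some `g` iff
  `oddPart F ∈ J` and every exponent `α` carrying a non-zero coefficient of some `sqPart F ε`, `ε ≠ 0`, has `v^{2α} ∈ J` (⇒ is the direction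
  the chain consumes: stub-3 K-GG3, stub-2 K-GG2).

K-GG1 (D3) (substitution law) and K-GG5 (2-basis-dual frames; FILE B) are NOT here. NOTHING in this file is a statement of H. Hironaka's manuscript
[Hironaka2017]; OURS chain vocabulary and kernel, candidates not facts. AI-written; AI review is weaker than expert review.
References (orientation only): H. Matsumura, *Commutative Ring Theory*, §26 (p-bases). [Matsumura1987]
-/

set_option linter.dupNamespace false

namespace Summit.ResolutionOfSingularities.ResolutionOfSingularities.Theorems.SwitchingDichotomy.TwoBasis

open scoped BigOperators

/-- the 2-monomial `λ^ε = ∏ i, λ i ^ ε i` of a finite family, `ε : Fin r → Fin 2`. OURS (notation) [invented: ours]. -/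
def lamPow {F : Type} [CommSemiring F] {r : ℕ} (lam : Fin r → F) (ε : Fin r → Fin 2) : F := ∏ i, lam i ^ ((ε i : ℕ))

/-- `λ` is a FINITE 2-BASIS of `F`: every element is uniquely `∑ ε, λ^ε · b ε ^ 2` (i.e. the `λ^ε` are an `F²`-basis of `F`; Matsumura §26 «p-basis», p = 2,
finite case, carried as data + this hypothesis since Mathlib has no `IsPBasis`). OURS (vocabulary) [invented: ours]. -/
def IsTwoBasis {F : Type} [CommSemiring F] {r : ℕ} (lam : Fin r → F) : Prop :=
  ∀ a : F, ∃! b : (Fin r → Fin 2) → F, a = ∑ ε, lamPow lam ε * b ε ^ 2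

variable {K : Type} [Field K] [CharP K 2] {c r : ℕ}

/-! ## The 2-basis: zero test and uniqueness -/

/-- `λ^0 = 1`. [invented: ours] -/
theorem lamPow_zero {F : Type} [CommSemiring F] (lam : Fin r → F) : lamPow lam 0 = 1 := by
  simp [lamPow]

omit [CharP K 2] in
/-- Uniqueness in a 2-basis: two representations `∑ λ^ε b_ε² = ∑ λ^ε b'_ε²` have `b = b'`. [invented: ours] -/
theorem IsTwoBasis.eq_of_sum_eq {lam : Fin r → K} (hB : IsTwoBasis lam) {b b' : (Fin r → Fin 2) → K}
    (h : ∑ ε, lamPow lam ε * b ε ^ 2 = ∑ ε, lamPow lam ε * b' ε ^ 2) : b = b' :=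
  (hB _).unique rfl h

omit [CharP K 2] in
/-- Zero test in a 2-basis: `∑ λ^ε b_ε² = 0 ↔ b = 0`. [invented: ours] -/
theorem IsTwoBasis.sum_eq_zero_iff {lam : Fin r → K} (hB : IsTwoBasis lam) (b : (Fin r → Fin 2) → K) :
    ∑ ε, lamPow lam ε * b ε ^ 2 = 0 ↔ b = 0 := by
  constructor
  · intro h
    refine hB.eq_of_sum_eq (h.trans ?_)
    simp
  · rintro rfl
    simp

/-! ## Frobenius on `MvPowerSeries` in characteristic 2 -/

section Frobenius

variable {σ : Type} [DecidableEq σ]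

omit [DecidableEq σ] in
/-- `β` has only even entries iff `β = 2 • α` for some `α`. [folklore] -/
theorem forall_even_iff_exists_two_nsmul (β : σ →₀ ℕ) : (∀ i, Even (β i)) ↔ ∃ α : σ →₀ ℕ, β = 2 • α := by
  constructor
  · intro h
    refine ⟨β.mapRange (· / 2) (by simp), Finsupp.ext fun i => ?_⟩
    simp only [Finsupp.smul_apply, Finsupp.mapRange_apply, smul_eq_mul]
    obtain ⟨m, hm⟩ := h i
    omega
  · rintro ⟨α, rfl⟩ i
    exact ⟨α i, by simp [two_mul]⟩

omit [DecidableEq σ] in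
/-- `α ↦ 2 • α` is injective on exponents. [folklore] -/
theorem two_nsmul_injective : Function.Injective fun α : σ →₀ ℕ => 2 • α := by
  intro α α' h
  ext i
  have := congrArg (fun γ : σ →₀ ℕ => γ i) h
  simp only [Finsupp.smul_apply, smul_eq_mul] at this
  omega

omit [DecidableEq σ] in
/-- In characteristic 2, `p.1 + p.2 = 2 • α` with `p.1 = p.2` forces `p = (α, α)`. [folklore] -/
theorem eq_of_add_self_eq_two_nsmul {γ α : σ →₀ ℕ} (h : γ + γ = 2 • α) : γ = α := by
  ext i
  have := congrArg (fun δ : σ →₀ ℕ => δ i) h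
  simp only [Finsupp.add_apply, Finsupp.smul_apply, smul_eq_mul] at this
  omega

variable {R : Type} [CommRing R] [CharP R 2]

/-- The off-diagonal part of `coeff β (G·G)` vanishes in characteristic 2 (swap involution on the antidiagonal). [folklore] -/
theorem sum_antidiagonal_filter_ne_eq_zero (G : MvPowerSeries σ R) (β : σ →₀ ℕ) :
    ∑ p ∈ (Finset.HasAntidiagonal.antidiagonal β).filter (fun p => p.1 ≠ p.2),
      MvPowerSeries.coeff p.1 G * MvPowerSeries.coeff p.2 G = 0 := by
  refine Finset.sum_involution (fun p _ => p.swap) ?_ ?_ ?_ ?_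
  · intro p hp
    rw [Prod.fst_swap, Prod.snd_swap, mul_comm (MvPowerSeries.coeff p.2 G), CharTwo.add_self_eq_zero]
  · intro p hp _
    rw [Finset.mem_filter] at hp
    intro h
    exact hp.2 (by simpa using (congrArg Prod.fst h).symm)
  · intro p hp
    rw [Finset.mem_filter, Finset.HasAntidiagonal.mem_antidiagonal] at hp ⊢
    exact ⟨by rw [Prod.fst_swap, Prod.snd_swap, add_comm]; exact hp.1, fun h => hp.2 h.symm⟩
  · intro p hp
    rfl

/-- **`coeff (2•α) (G²) = (coeff α G)²`** in characteristic 2. [folklore] -/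
theorem coeff_two_nsmul_sq (G : MvPowerSeries σ R) (α : σ →₀ ℕ) :
    MvPowerSeries.coeff (2 • α) (G ^ 2) = MvPowerSeries.coeff α G ^ 2 := by
  rw [pow_two, pow_two, MvPowerSeries.coeff_mul,
    ← Finset.sum_filter_add_sum_filter_not (Finset.HasAntidiagonal.antidiagonal (2 • α)) (fun p => p.1 ≠ p.2),
    sum_antidiagonal_filter_ne_eq_zero, zero_add]
  have hdiag : (Finset.HasAntidiagonal.antidiagonal (2 • α)).filter (fun p => ¬ p.1 ≠ p.2) = {(α, α)} := by
    ext p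
    simp only [Finset.mem_filter, Finset.HasAntidiagonal.mem_antidiagonal, ne_eq, not_not, Finset.mem_singleton]
    constructor
    · rintro ⟨hsum, heq⟩
      have h1 : p.1 = α := eq_of_add_self_eq_two_nsmul (by rw [← hsum, heq])
      exact Prod.ext h1 (heq ▸ h1)
    · rintro rfl
      exact ⟨(two_nsmul α).symm, rfl⟩
  rw [hdiag, Finset.sum_singleton]

/-- **`coeff β (G²) = 0`** when `β` is not of the form `2 • α` (characteristic 2). [folklore] -/
theorem coeff_sq_eq_zero_of_not_even (G : MvPowerSeries σ R) {β : σ →₀ ℕ} (hβ : ¬ ∀ i, Even (β i)) :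
    MvPowerSeries.coeff β (G ^ 2) = 0 := by
  rw [pow_two, MvPowerSeries.coeff_mul,
    ← Finset.sum_filter_add_sum_filter_not (Finset.HasAntidiagonal.antidiagonal β) (fun p => p.1 ≠ p.2),
    sum_antidiagonal_filter_ne_eq_zero, zero_add]
  refine Finset.sum_eq_zero fun p hp => ?_
  exfalso
  simp only [Finset.mem_filter, Finset.HasAntidiagonal.mem_antidiagonal, ne_eq, not_not] at hp
  refine hβ ((forall_even_iff_exists_two_nsmul β).mpr ⟨p.1, ?_⟩)
  rw [← hp.1, hp.2, two_nsmul]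

end Frobenius

/-! ## The square part of a candidate decomposition, coefficientwise -/

/-- Coefficients of `∑_ε C(λ^ε) · (D ε)²` at an even exponent: `∑_ε λ^ε (coeff α (D ε))²`. [invented: ours] -/
theorem coeff_two_nsmul_sum_C_mul_sq (lam : Fin r → K) (D : (Fin r → Fin 2) → MvPowerSeries (Fin c) K) (α : Fin c →₀ ℕ) :
    MvPowerSeries.coeff (2 • α) (∑ ε, MvPowerSeries.C (lamPow lam ε) * (D ε) ^ 2) =
      ∑ ε, lamPow lam ε * MvPowerSeries.coeff α (D ε) ^ 2 := by
  rw [map_sum]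
  refine Finset.sum_congr rfl fun ε _ => ?_
  rw [MvPowerSeries.coeff_C_mul, coeff_two_nsmul_sq]

/-- … and they vanish at exponents with an odd entry. [invented: ours] -/
theorem coeff_sum_C_mul_sq_eq_zero_of_not_even (lam : Fin r → K) (D : (Fin r → Fin 2) → MvPowerSeries (Fin c) K)
    {β : Fin c →₀ ℕ} (hβ : ¬ ∀ i, Even (β i)) :
    MvPowerSeries.coeff β (∑ ε, MvPowerSeries.C (lamPow lam ε) * (D ε) ^ 2) = 0 := by
  rw [map_sum]
  refine Finset.sum_eq_zero fun ε _ => ?_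
  rw [MvPowerSeries.coeff_C_mul, coeff_sq_eq_zero_of_not_even _ hβ, mul_zero]

/-! ## K-GG1 (D1): the λ-decomposition -/

/-- **K-GG1 (D1)** λ-DECOMPOSITION of a power series over a field with a finite 2-basis: `F = ∑ ε, C(λ^ε) · (D₁ ε)² + D₂` with `D₂` supported on
exponents having an odd entry, uniquely (coefficientwise: `coeff (2•α) F = ∑ ε, λ^ε · (coeff α (D₁ ε))²`). M (tri-1). [invented: ours] -/
theorem lambdaDecomp_existsUnique (lam : Fin r → K) (hB : IsTwoBasis lam) (F : MvPowerSeries (Fin c) K) :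
    ∃! D : ((Fin r → Fin 2) → MvPowerSeries (Fin c) K) × MvPowerSeries (Fin c) K,
      F = (∑ ε, MvPowerSeries.C (lamPow lam ε) * (D.1 ε) ^ 2) + D.2 ∧
        ∀ α : Fin c →₀ ℕ, (∀ i, Even (α i)) → MvPowerSeries.coeff α D.2 = 0 := by
  classical
  -- the unique solution `b α` of `coeff (2•α) F = ∑ λ^ε (b α ε)²`
  let b : (Fin c →₀ ℕ) → (Fin r → Fin 2) → K := fun α => (hB (MvPowerSeries.coeff (2 • α) F)).exists.choose
  have hb : ∀ α, MvPowerSeries.coeff (2 • α) F = ∑ ε, lamPow lam ε * b α ε ^ 2 := fun α =>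
    (hB (MvPowerSeries.coeff (2 • α) F)).exists.choose_spec
  -- the candidate: `D₁ ε = ∑_α b α ε · v^α`, `D₂ = the odd-exponent part of F`
  let D₁ : (Fin r → Fin 2) → MvPowerSeries (Fin c) K := fun ε α => b α ε
  let D₂ : MvPowerSeries (Fin c) K := fun β => if ∀ i, Even (β i) then 0 else MvPowerSeries.coeff β F
  have hD₁ : ∀ ε α, MvPowerSeries.coeff α (D₁ ε) = b α ε := fun ε α => rfl
  have hD₂ : ∀ β, MvPowerSeries.coeff β D₂ = if ∀ i, Even (β i) then 0 else MvPowerSeries.coeff β F := fun β => rfl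
  refine ⟨(D₁, D₂), ⟨?_, fun α hα => by rw [hD₂, if_pos hα]⟩, ?_⟩
  · -- `F = ∑ C(λ^ε) (D₁ ε)² + D₂` coefficientwise
    refine MvPowerSeries.ext fun β => ?_
    rw [map_add, hD₂]
    by_cases hβ : ∀ i, Even (β i)
    · obtain ⟨α, rfl⟩ := (forall_even_iff_exists_two_nsmul β).mp hβ
      rw [if_pos hβ, add_zero, coeff_two_nsmul_sum_C_mul_sq, hb α]
      rfl
    · rw [if_neg hβ, coeff_sum_C_mul_sq_eq_zero_of_not_even _ _ hβ, zero_add]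
  · -- uniqueness
    rintro ⟨D₁', D₂'⟩ ⟨hF, hD₂'⟩
    have h1 : D₁' = D₁ := by
      funext ε
      refine MvPowerSeries.ext fun α => ?_
      have hα : MvPowerSeries.coeff (2 • α) F = ∑ ε, lamPow lam ε * MvPowerSeries.coeff α (D₁' ε) ^ 2 := by
        rw [hF, map_add, coeff_two_nsmul_sum_C_mul_sq,
          hD₂' _ ((forall_even_iff_exists_two_nsmul _).mpr ⟨α, rfl⟩), add_zero]
      have hbb : (fun ε => MvPowerSeries.coeff α (D₁' ε)) = b α := hB.eq_of_sum_eq (hα.symm.trans (hb α))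
      rw [hD₁]
      exact congrFun hbb ε
    have h2 : D₂' = D₂ := by
      refine MvPowerSeries.ext fun β => ?_
      rw [hD₂]
      by_cases hβ : ∀ i, Even (β i)
      · rw [if_pos hβ, hD₂' β hβ]
      · rw [if_neg hβ]
        have h := congrArg (MvPowerSeries.coeff β) hF
        rw [map_add, coeff_sum_C_mul_sq_eq_zero_of_not_even _ _ hβ, zero_add] at h
        exact h.symm
    rw [h1, h2]

/-- the square parts `sqPart lam hB F ε` and the odd part `oddPart lam hB F` of (D1). [invented: ours] -/
noncomputable def sqPart (lam : Fin r → K) (hB : IsTwoBasis lam) (F : MvPowerSeries (Fin c) K) :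
    (Fin r → Fin 2) → MvPowerSeries (Fin c) K := (lambdaDecomp_existsUnique lam hB F).choose.1

/-- see `sqPart`. [invented: ours] -/
noncomputable def oddPart (lam : Fin r → K) (hB : IsTwoBasis lam) (F : MvPowerSeries (Fin c) K) :
    MvPowerSeries (Fin c) K := (lambdaDecomp_existsUnique lam hB F).choose.2

/-- The decomposition equation `F = ∑ ε, C(λ^ε) · (sqPart F ε)² + oddPart F`. [invented: ours] -/
theorem eq_sum_sqPart_add_oddPart (lam : Fin r → K) (hB : IsTwoBasis lam) (F : MvPowerSeries (Fin c) K) :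
    F = (∑ ε, MvPowerSeries.C (lamPow lam ε) * (sqPart lam hB F ε) ^ 2) + oddPart lam hB F :=
  (lambdaDecomp_existsUnique lam hB F).choose_spec.1.1

/-- `oddPart F` vanishes on even exponents. [invented: ours] -/
theorem coeff_oddPart_of_even (lam : Fin r → K) (hB : IsTwoBasis lam) (F : MvPowerSeries (Fin c) K)
    {α : Fin c →₀ ℕ} (hα : ∀ i, Even (α i)) : MvPowerSeries.coeff α (oddPart lam hB F) = 0 :=
  (lambdaDecomp_existsUnique lam hB F).choose_spec.1.2 α hα

/-- `oddPart F` agrees with `F` off the even exponents. [invented: ours] -/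
theorem coeff_oddPart_of_not_even (lam : Fin r → K) (hB : IsTwoBasis lam) (F : MvPowerSeries (Fin c) K)
    {β : Fin c →₀ ℕ} (hβ : ¬ ∀ i, Even (β i)) : MvPowerSeries.coeff β (oddPart lam hB F) = MvPowerSeries.coeff β F := by
  have h := congrArg (MvPowerSeries.coeff β) (eq_sum_sqPart_add_oddPart lam hB F)
  rw [map_add, coeff_sum_C_mul_sq_eq_zero_of_not_even _ _ hβ, zero_add] at h
  exact h.symm

/-- The even coefficients of `F`: `coeff (2•α) F = ∑ ε, λ^ε (coeff α (sqPart F ε))²`. [invented: ours] -/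
theorem coeff_two_nsmul_eq_sum_sqPart (lam : Fin r → K) (hB : IsTwoBasis lam) (F : MvPowerSeries (Fin c) K) (α : Fin c →₀ ℕ) :
    MvPowerSeries.coeff (2 • α) F = ∑ ε, lamPow lam ε * MvPowerSeries.coeff α (sqPart lam hB F ε) ^ 2 := by
  have h := congrArg (MvPowerSeries.coeff (2 • α)) (eq_sum_sqPart_add_oddPart lam hB F)
  rwa [map_add, coeff_two_nsmul_sum_C_mul_sq,
    coeff_oddPart_of_even lam hB F ((forall_even_iff_exists_two_nsmul _).mpr ⟨α, rfl⟩), add_zero] at h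

/-- Uniqueness of the decomposition as a rewriting tool: any `(D₁, D₂)` with the two properties IS `(sqPart, oddPart)`. [invented: ours] -/
theorem sqPart_oddPart_unique (lam : Fin r → K) (hB : IsTwoBasis lam) (F : MvPowerSeries (Fin c) K)
    (D₁ : (Fin r → Fin 2) → MvPowerSeries (Fin c) K) (D₂ : MvPowerSeries (Fin c) K)
    (hF : F = (∑ ε, MvPowerSeries.C (lamPow lam ε) * (D₁ ε) ^ 2) + D₂)
    (hD₂ : ∀ α : Fin c →₀ ℕ, (∀ i, Even (α i)) → MvPowerSeries.coeff α D₂ = 0) :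
    sqPart lam hB F = D₁ ∧ oddPart lam hB F = D₂ := by
  have h1 : ((D₁, D₂) : ((Fin r → Fin 2) → MvPowerSeries (Fin c) K) × MvPowerSeries (Fin c) K) =
      (lambdaDecomp_existsUnique lam hB F).choose :=
    (lambdaDecomp_existsUnique lam hB F).choose_spec.2 (D₁, D₂) ⟨hF, hD₂⟩
  constructor
  · show (lambdaDecomp_existsUnique lam hB F).choose.1 = D₁
    rw [← h1]
  · show (lambdaDecomp_existsUnique lam hB F).choose.2 = D₂
    rw [← h1]

/-! ## Monomial ideals of `V` -/

section MonomialIdeal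

variable (J : Ideal (MvPowerSeries (Fin c) K))

omit [CharP K 2] in
/-- For a non-zero scalar `a`, `a · v^α ∈ J ↔ v^α ∈ J`. [folklore] -/
theorem monomial_mem_iff_monomial_one_mem {α : Fin c →₀ ℕ} {a : K} (ha : a ≠ 0) :
    MvPowerSeries.monomial α a ∈ J ↔ MvPowerSeries.monomial α (1 : K) ∈ J := by
  have h1 : MvPowerSeries.monomial α a = MvPowerSeries.C a * MvPowerSeries.monomial α (1 : K) := by
    rw [← MvPowerSeries.monomial_zero_eq_C_apply, MvPowerSeries.monomial_mul_monomial, zero_add, mul_one]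
  have hu : IsUnit (MvPowerSeries.C a : MvPowerSeries (Fin c) K) := (isUnit_iff_ne_zero.mpr ha).map _
  rw [h1]
  exact ⟨fun h => by simpa [← mul_assoc, hu.unit.inv_mul] using J.mul_mem_left (↑hu.unit⁻¹) h,
    fun h => J.mul_mem_left _ h⟩

omit [CharP K 2] in
/-- In an ideal closed under monomial components, membership of `G` reads coefficientwise: every exponent with a non-zero coefficient
has its monic monomial in `J`. [folklore] -/
theorem mem_iff_forall_monomial_one_mem
    (hJ : ∀ G, G ∈ J ↔ ∀ α, MvPowerSeries.monomial α (MvPowerSeries.coeff α G) ∈ J) (G : MvPowerSeries (Fin c) K) :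
    G ∈ J ↔ ∀ α, MvPowerSeries.coeff α G ≠ 0 → MvPowerSeries.monomial α (1 : K) ∈ J := by
  rw [hJ]
  refine forall_congr' fun α => ?_
  by_cases h : MvPowerSeries.coeff α G = 0
  · simp only [h, map_zero, Submodule.zero_mem, ne_eq, not_true_eq_false, IsEmpty.forall_iff]
  · rw [monomial_mem_iff_monomial_one_mem J h]
    simp only [ne_eq, h, not_false_eq_true, forall_const]

end MonomialIdeal

/-! ## K-GG1 (D2): square classes modulo a monomial ideal -/

/-- Subtracting a square only moves the `ε = 0` square part: `F − g² = ∑ ε, C(λ^ε)·(D₁' ε)² + oddPart F` with `D₁' 0 = sqPart F 0 − g`,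
`D₁' ε = sqPart F ε` otherwise. [invented: ours] -/
theorem sqPart_sub_sq (lam : Fin r → K) (hB : IsTwoBasis lam) (F g : MvPowerSeries (Fin c) K) :
    sqPart lam hB (F - g ^ 2) = Function.update (sqPart lam hB F) 0 (sqPart lam hB F 0 - g) ∧
      oddPart lam hB (F - g ^ 2) = oddPart lam hB F := by
  classical
  haveI : CharP (MvPowerSeries (Fin c) K) 2 :=
    charP_of_injective_algebraMap (MvPowerSeries.C_injective (σ := Fin c) (R := K)) 2
  set D₁' := Function.update (sqPart lam hB F) 0 (sqPart lam hB F 0 - g) with hD₁'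
  refine sqPart_oddPart_unique lam hB (F - g ^ 2) D₁' _ ?_ (fun α hα => coeff_oddPart_of_even lam hB F hα)
  -- split both square sums at `ε = 0`
  have hsplit : ∀ D : (Fin r → Fin 2) → MvPowerSeries (Fin c) K,
      (∑ ε, MvPowerSeries.C (lamPow lam ε) * (D ε) ^ 2) =
        MvPowerSeries.C (lamPow lam 0) * (D 0) ^ 2 +
          ∑ ε ∈ Finset.univ.erase 0, MvPowerSeries.C (lamPow lam ε) * (D ε) ^ 2 := fun D =>
    (Finset.add_sum_erase _ _ (Finset.mem_univ _)).symm
  have hrest : ∑ ε ∈ Finset.univ.erase 0, MvPowerSeries.C (lamPow lam ε) * (D₁' ε) ^ 2 =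
      ∑ ε ∈ Finset.univ.erase 0, MvPowerSeries.C (lamPow lam ε) * (sqPart lam hB F ε) ^ 2 :=
    Finset.sum_congr rfl fun ε hε => by rw [hD₁', Function.update_of_ne (Finset.ne_of_mem_erase hε)]
  have h0 : D₁' 0 = sqPart lam hB F 0 - g := by rw [hD₁', Function.update_self]
  have key : (∑ ε, MvPowerSeries.C (lamPow lam ε) * (D₁' ε) ^ 2) =
      (∑ ε, MvPowerSeries.C (lamPow lam ε) * (sqPart lam hB F ε) ^ 2) - g ^ 2 := by
    rw [hsplit D₁', hsplit (sqPart lam hB F), hrest, h0, lamPow_zero, map_one, one_mul, one_mul, sub_pow_char]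
    ring
  rw [key]
  have hF := eq_sum_sqPart_add_oddPart lam hB F
  -- `F - g² = (S - g²) + oddPart F` from `F = S + oddPart F`
  nth_rewrite 1 [hF]
  ring

/-- **K-GG1 (D2)** square-class membership in a MONOMIAL ideal `J` (closed under taking monomial components): `F − g² ∈ J` for some `g` iff the
odd part lies in `J` and every monomial carrying a non-trivial `λ^ε`-square part has its square in `J`. S–M (tri-1; ⇒ is the consumed direction).
[invented: ours] -/
theorem exists_sub_sq_mem_iff_of_isMonomial (lam : Fin r → K) (hB : IsTwoBasis lam) (J : Ideal (MvPowerSeries (Fin c) K))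
    (hJ : ∀ G, G ∈ J ↔ ∀ α, MvPowerSeries.monomial α (MvPowerSeries.coeff α G) ∈ J) (F : MvPowerSeries (Fin c) K) :
    (∃ g, F - g ^ 2 ∈ J) ↔
      oddPart lam hB F ∈ J ∧ ∀ ε : Fin r → Fin 2, ε ≠ 0 → ∀ α : Fin c →₀ ℕ,
        MvPowerSeries.coeff α (sqPart lam hB F ε) ≠ 0 → MvPowerSeries.monomial (2 • α) (1 : K) ∈ J := by
  classical
  constructor
  · rintro ⟨g, hg⟩
    obtain ⟨hsq, hodd⟩ := sqPart_sub_sq lam hB F g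
    rw [mem_iff_forall_monomial_one_mem J hJ] at hg
    refine ⟨?_, fun ε hε α hα => ?_⟩
    · -- the odd part: its coefficients are those of `F − g²` off the even exponents
      rw [mem_iff_forall_monomial_one_mem J hJ]
      intro β hβ
      have hβodd : ¬ ∀ i, Even (β i) := fun h => hβ (coeff_oddPart_of_even lam hB F h)
      refine hg β ?_
      rwa [← coeff_oddPart_of_not_even lam hB (F - g ^ 2) hβodd, hodd]
    · -- a non-trivial square part at `α` makes `coeff (2•α) (F − g²) ≠ 0` by the 2-basis zero test
      refine hg (2 • α) fun h0 => ?_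
      rw [coeff_two_nsmul_eq_sum_sqPart lam hB (F - g ^ 2), hsq, hB.sum_eq_zero_iff] at h0
      have := congrFun h0 ε
      rw [Function.update_of_ne hε] at this
      exact hα (by rw [this]; rfl)
  · rintro ⟨hodd, hsq⟩
    refine ⟨sqPart lam hB F 0, ?_⟩
    obtain ⟨hsq', hodd'⟩ := sqPart_sub_sq lam hB F (sqPart lam hB F 0)
    rw [mem_iff_forall_monomial_one_mem J hJ]
    intro β hβ
    by_cases hβe : ∀ i, Even (β i)
    · obtain ⟨α, rfl⟩ := (forall_even_iff_exists_two_nsmul β).mp hβe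
      rw [coeff_two_nsmul_eq_sum_sqPart lam hB (F - sqPart lam hB F 0 ^ 2), hsq'] at hβ
      -- some `ε` carries a non-zero coefficient; it is not `ε = 0` (that entry is `sqPart F 0 − sqPart F 0 = 0`)
      obtain ⟨ε, -, hε⟩ := Finset.exists_ne_zero_of_sum_ne_zero hβ
      have hε0 : ε ≠ 0 := by
        rintro rfl
        rw [Function.update_self, sub_self] at hε
        exact hε (by simp)
      rw [Function.update_of_ne hε0] at hε
      exact hsq ε hε0 α fun h => hε (by rw [h]; simp)
    · rw [coeff_oddPart_of_not_even lam hB _ hβe |>.symm, hodd'] at hβ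
      exact (mem_iff_forall_monomial_one_mem J hJ (oddPart lam hB F)).mp hodd β hβ

end Summit.ResolutionOfSingularities.ResolutionOfSingularities.Theorems.SwitchingDichotomy.TwoBasis
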